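/-
Copyright: the b2b-balaban T⁴-continuum CRUX team, row NE7b OWNER lineage `t4-ne7b-p1` (gen 141). Project licence.
-/
import Summits.QuantumFields.BalabanUV.T4Continuum.Spine.NE7b.SupTruncationCumulantBound

/-!
# TRUNCATION ACROSS A CUT: THE FOUR-FACTOR GROUP BOUND (SCOPING (d13)(2), first file — the order-4 analogue of (460)).  At order 4 the
# distinguished-vertex argument of (461) FAILS (two far-apart close pairs: every vertex has a near neighbour), and the fourth cumulant must be
# controlled through CUTS: for the bipartition `{1,2}|{3,4}`, `u₄ = Cov(f̃g̃, h̃k̃) − u₂(13)u₂(24) − u₂(14)u₂(23)`, so one needs a bound on the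
# covariance of two PRODUCTS of centred observables.  Neither product is Lipschitz; clamping every factor at level `R` (`T_Ru = max(−R, min(R,u))`)
# makes both products Lipschitz (vectors `R·(a_f + a_g)`, `R·(a_h + a_k)` — (461) `clamped_prod_lipVec`), so Dobrushin's bound applies to the
# clamped pair with a factor `R²`, and THIS FILE prices the defect:
#   `|Cov(fg, hk) − Cov(T_Rf·T_Rg, T_Rh·T_Rk)| ≤ (2m₄ + 2m₆ + 2m₂(m₂ + m₄))∕R`
# for any four measurable functions with second∕fourth∕sixth moments `≤ m₂, m₄, m₆` under a probability measure; hence, if the clamped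
# covariance is `≤ R²·B`, `|Cov(fg,hk)| ≤ R²B + c∕R` for EVERY `R > 0` — the successor chooses `R` as a power of the site weight (no cube
# roots) (row NE7b, node U5c; (460) `prod_sub_clamp_prod_abs_le` BY NAME; Mathlib measure theory; [folklore])

Cell `pub-balaban`, sub-cell `t4`, spine estimate NE7b (`T4WeightBudget.RelWeightBound`; the cell's OWN estimate — NOT PRINTED in
[Bałaban 1983–89], NOT PROVED).  Crux-route work under `Spine/NE7b/` by the row OWNER (`t4-ne7b-p1` gen 141, file (486)) under FREEZE
(0)'s crux-prover clause; NOTHING of Bałaban's is named as a Lean object, valued or asserted; no `T4Continuum/Support` leaf typed; no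
`def`, no notation (the clamp WRITTEN OUT as `max (-R) (min R ·)`); zero `sorry`.  Imports (BY NAME): the OWNER's (460)
`…SupTruncationCumulantBound` (`prod_sub_clamp_prod_abs_le`; the clamp facts `|T_Ru| ≤ |u|`, `|u − T_Ru|·R ≤ u²` are the tree's
`Literature.Analysis.FunctionSpaces.abs_clamp_le_abs` ∕ `…abs_sub_clamp_le_sq_div` — inlined as `have`s).

WHAT IS PROVED ([folklore]):
* §1 pointwise: `amgm_cubes`, `sq_mul_three_le`, `sq_mul_abs_three_le`, `abs_quad_le`, `sq_mul_abs_le`, **`quad_sub_clamp_quad_abs_le`**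
  (`|abcd − T_Ra·T_Rb·T_Rc·T_Rd| ≤ (Σa⁴ + Σa⁶)∕(2R)`).
* §2 expectations (probability measure; fourth and sixth moments integrable): `integrable_sq_of_quartic`, `integrable_quad`, `integrable_quad_clamped`,
  `integrable_pair`, `integrable_pair_clamped`, `group_expect_defect_le`, `pair_expect_defect_le`, `abs_expect_pair_le`, `abs_expect_clamped_pair_le`.
* §3 THE ENDS **`cov_group_split_le`** (the display) and **`cov_group_le_of_truncated`** (`|Cov(fg,hk)| ≤ R²B + c∕R`).

HONEST (what this is NOT).  Real inequalities and their integrals; the Dobrushin bound for two clamped products, sixth moments, the moment–cumulant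
identities at `n = 4`, the cut∕tree lemma and the `u₄` kernel letter are the next files; the cumulant FORM of `∂⁴W` is NOT typed; scalar skeleton
((A3), NC-NE7b-α UNRULED); nothing of Bałaban's asserted.  BY-NAME EFFECT ON THE WALL: NONE.  NE7b NOT PRINTED ∕ NOT PROVED; spine PROVED 0∕9;
rung (B)+1 — FINITE-torus statements; NOT the mass gap, NOT Clay.  HONEST DEPENDENCY: continuum YM on T⁴ ⇐ BetaPertH ∧ nine spine estimates
(0∕9 proved); BetaPertH ⇐ (D1) ∧ (D4) ∧ CAP+tail; G-an2-4 gates asym, D1 and NE2∕3∕4.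
-/

set_option autoImplicit false

noncomputable section

namespace Summit.QuantumFields.BalabanUV.T4Continuum.NE7b.SupTruncationGroupBound

open MeasureTheory Real
open SupTruncationCumulantBound (prod_sub_clamp_prod_abs_le)

/-! ## §1. Pointwise inequalities -/

/-- `xyz ≤ (x³ + y³ + z³)∕3` for `x, y, z ≥ 0`. [folklore] -/
theorem amgm_cubes {x y z : ℝ} (hx : 0 ≤ x) (hy : 0 ≤ y) (hz : 0 ≤ z) : x * y * z ≤ (x ^ 3 + y ^ 3 + z ^ 3) / 3 := by
  nlinarith [mul_nonneg (add_nonneg (add_nonneg hx hy) hz) (add_nonneg (add_nonneg (sq_nonneg (x - y)) (sq_nonneg (y - z))) (sq_nonneg (x - z)))]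

/-- `x²yzw ≤ (x⁴ + y⁴)∕4 + (x⁶ + z⁶ + w⁶)∕6` for all reals (two arithmetic–geometric means). [folklore] -/
theorem sq_mul_three_le (x y z w : ℝ) : x ^ 2 * y * z * w ≤ (x ^ 4 + y ^ 4) / 4 + (x ^ 6 + z ^ 6 + w ^ 6) / 6 := by
  have h1 : x ^ 2 * y * z * w ≤ (x ^ 2 * y ^ 2 + x ^ 2 * (z ^ 2 * w ^ 2)) / 2 := by nlinarith [sq_nonneg (x * y - x * (z * w))]
  have h2 : x ^ 2 * y ^ 2 ≤ (x ^ 4 + y ^ 4) / 2 := by nlinarith [sq_nonneg (x ^ 2 - y ^ 2)]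
  have h3 : x ^ 2 * (z ^ 2 * w ^ 2) ≤ (x ^ 6 + z ^ 6 + w ^ 6) / 3 := by
    have h := amgm_cubes (sq_nonneg x) (sq_nonneg z) (sq_nonneg w)
    calc x ^ 2 * (z ^ 2 * w ^ 2) = x ^ 2 * z ^ 2 * w ^ 2 := by ring
      _ ≤ ((x ^ 2) ^ 3 + (z ^ 2) ^ 3 + (w ^ 2) ^ 3) / 3 := h
      _ = (x ^ 6 + z ^ 6 + w ^ 6) / 3 := by ring
  linarith

/-- `p²|q||r||s| ≤ (p⁴ + q⁴)∕4 + (p⁶ + r⁶ + s⁶)∕6`. [folklore] -/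
theorem sq_mul_abs_three_le (p q r s : ℝ) : p ^ 2 * |q| * |r| * |s| ≤ (p ^ 4 + q ^ 4) / 4 + (p ^ 6 + r ^ 6 + s ^ 6) / 6 := by
  have h := sq_mul_three_le |p| |q| |r| |s|
  have e2 : |p| ^ 2 = p ^ 2 := sq_abs p
  have e4 : ∀ u : ℝ, |u| ^ 4 = u ^ 4 := fun u => Even.pow_abs ⟨2, rfl⟩ u
  have e6 : ∀ u : ℝ, |u| ^ 6 = u ^ 6 := fun u => Even.pow_abs ⟨3, rfl⟩ u
  rw [e2, e4, e4, e6, e6, e6] at h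
  exact h

/-- `|abcd| ≤ (a⁴ + b⁴ + c⁴ + d⁴)∕4`. [folklore] -/
theorem abs_quad_le (a b c d : ℝ) : |a * b * c * d| ≤ (a ^ 4 + b ^ 4 + c ^ 4 + d ^ 4) / 4 := by
  rw [abs_mul, abs_mul, abs_mul]
  have h1 : |a| * |b| ≤ (a ^ 2 + b ^ 2) / 2 := by nlinarith [sq_nonneg (|a| - |b|), sq_abs a, sq_abs b]
  have h2 : |c| * |d| ≤ (c ^ 2 + d ^ 2) / 2 := by nlinarith [sq_nonneg (|c| - |d|), sq_abs c, sq_abs d]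
  have h3 : (a ^ 2 + b ^ 2) / 2 * ((c ^ 2 + d ^ 2) / 2) ≤ (((a ^ 2 + b ^ 2) / 2) ^ 2 + ((c ^ 2 + d ^ 2) / 2) ^ 2) / 2 := by
    nlinarith [sq_nonneg ((a ^ 2 + b ^ 2) / 2 - (c ^ 2 + d ^ 2) / 2)]
  have h4 : ((a ^ 2 + b ^ 2) / 2) ^ 2 ≤ (a ^ 4 + b ^ 4) / 2 := by nlinarith [sq_nonneg (a ^ 2 - b ^ 2)]
  have h5 : ((c ^ 2 + d ^ 2) / 2) ^ 2 ≤ (c ^ 4 + d ^ 4) / 2 := by nlinarith [sq_nonneg (c ^ 2 - d ^ 2)]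
  calc |a| * |b| * |c| * |d| = (|a| * |b|) * (|c| * |d|) := by ring
    _ ≤ (a ^ 2 + b ^ 2) / 2 * ((c ^ 2 + d ^ 2) / 2) :=
        mul_le_mul h1 h2 (mul_nonneg (abs_nonneg _) (abs_nonneg _)) (by positivity)
    _ ≤ (a ^ 4 + b ^ 4 + c ^ 4 + d ^ 4) / 4 := by linarith

/-- `a²|b| ≤ (a⁴ + b²)∕2`. [folklore] -/
theorem sq_mul_abs_le (a b : ℝ) : a ^ 2 * |b| ≤ (a ^ 4 + b ^ 2) / 2 := by nlinarith [sq_nonneg (a ^ 2 - |b|), sq_abs b, abs_nonneg b]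

/-- **THE FOUR-FACTOR CLAMP DEFECT**: for `R > 0`,
`|abcd − T_Ra·T_Rb·T_Rc·T_Rd| ≤ ((a⁴+b⁴+c⁴+d⁴) + (a⁶+b⁶+c⁶+d⁶))∕(2R)`. [folklore] -/
theorem quad_sub_clamp_quad_abs_le {R : ℝ} (hR : 0 < R) (a b c d : ℝ) :
    |a * b * c * d - max (-R) (min R a) * max (-R) (min R b) * max (-R) (min R c) * max (-R) (min R d)| ≤
      ((a ^ 4 + b ^ 4 + c ^ 4 + d ^ 4) + (a ^ 6 + b ^ 6 + c ^ 6 + d ^ 6)) / (2 * R) := by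
  -- the clamp facts (the tree's `abs_clamp_le_abs`, `abs_sub_clamp_le_sq_div`, inlined)
  have hshrink : ∀ w : ℝ, |max (-R) (min R w)| ≤ |w| := fun w => by
    rcases le_or_gt w (-R) with h1 | h1
    · rw [min_eq_right (by linarith), max_eq_left h1, abs_of_nonpos (by linarith), abs_of_nonpos (by linarith)]; linarith
    · rcases le_or_gt w R with h2 | h2
      · rw [min_eq_right h2, max_eq_right h1.le]
      · rw [min_eq_left h2.le, max_eq_right (by linarith), abs_of_nonneg hR.le, abs_of_pos (by linarith)]; linarith
  have hdef : ∀ w : ℝ, |w - max (-R) (min R w)| * R ≤ w ^ 2 := fun w => by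
    rcases le_or_gt w (-R) with h1 | h1
    · rw [min_eq_right (by linarith), max_eq_left h1, abs_of_nonpos (by linarith)]; nlinarith
    · rcases le_or_gt w R with h2 | h2
      · rw [min_eq_right h2, max_eq_right h1.le, sub_self, abs_zero, zero_mul]; positivity
      · rw [min_eq_left h2.le, max_eq_right (by linarith), abs_of_nonneg (by linarith)]; nlinarith
  set A := max (-R) (min R a) with hA
  set B := max (-R) (min R b) with hB
  set C := max (-R) (min R c) with hC
  set D := max (-R) (min R d) with hD
  -- telescoping
  have e : a * b * c * d - A * B * C * D = (a - A) * b * c * d + A * (b - B) * c * d + A * B * (c - C) * d + A * B * C * (d - D) := by ring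
  rw [e]
  have hAa := hshrink a; have hBb := hshrink b; have hCc := hshrink c
  have t1 : |(a - A) * b * c * d| * R ≤ a ^ 2 * |b| * |c| * |d| := by
    rw [abs_mul, abs_mul, abs_mul]
    have h := hdef a
    have hnn : 0 ≤ |b| * |c| * |d| := by positivity
    nlinarith
  have t2 : |A * (b - B) * c * d| * R ≤ b ^ 2 * |a| * |c| * |d| := by
    rw [abs_mul, abs_mul, abs_mul]
    have h := hdef b
    have h' : |A| * (|c| * |d|) ≤ |a| * (|c| * |d|) := mul_le_mul_of_nonneg_right hAa (by positivity)
    have hnn : 0 ≤ |A| * |c| * |d| := by positivity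
    nlinarith [abs_nonneg (b - B)]
  have t3 : |A * B * (c - C) * d| * R ≤ c ^ 2 * |a| * |b| * |d| := by
    rw [abs_mul, abs_mul, abs_mul]
    have h := hdef c
    have h' : |A| * |B| * |d| ≤ |a| * |b| * |d| := by
      have := mul_le_mul hAa hBb (abs_nonneg _) (abs_nonneg _)
      exact mul_le_mul_of_nonneg_right this (abs_nonneg _)
    have hnn : 0 ≤ |A| * |B| * |d| := by positivity
    nlinarith [abs_nonneg (c - C)]
  have t4 : |A * B * C * (d - D)| * R ≤ d ^ 2 * |a| * |b| * |c| := by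
    rw [abs_mul, abs_mul, abs_mul]
    have h := hdef d
    have h' : |A| * |B| * |C| ≤ |a| * |b| * |c| := by
      have := mul_le_mul hAa hBb (abs_nonneg _) (abs_nonneg _)
      exact mul_le_mul this hCc (abs_nonneg _) (by positivity)
    have hnn : 0 ≤ |A| * |B| * |C| := by positivity
    nlinarith [abs_nonneg (d - D)]
  -- the four arithmetic–geometric means
  have s1 := sq_mul_abs_three_le a b c d
  have s2 := sq_mul_abs_three_le b a c d
  have s3 := sq_mul_abs_three_le c d a b
  have s4 := sq_mul_abs_three_le d c a b
  have r3 : c ^ 2 * |a| * |b| * |d| = c ^ 2 * |d| * |a| * |b| := by ring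
  have r4 : d ^ 2 * |a| * |b| * |c| = d ^ 2 * |c| * |a| * |b| := by ring
  rw [le_div_iff₀ (by positivity)]
  have tri : |(a - A) * b * c * d + A * (b - B) * c * d + A * B * (c - C) * d + A * B * C * (d - D)| ≤
      |(a - A) * b * c * d| + |A * (b - B) * c * d| + |A * B * (c - C) * d| + |A * B * C * (d - D)| := by
    have h1 := abs_add_le ((a - A) * b * c * d + A * (b - B) * c * d + A * B * (c - C) * d) (A * B * C * (d - D))
    have h2 := abs_add_le ((a - A) * b * c * d + A * (b - B) * c * d) (A * B * (c - C) * d)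
    have h3 := abs_add_le ((a - A) * b * c * d) (A * (b - B) * c * d)
    linarith
  nlinarith [tri, t1, t2, t3, t4, s1, s2, s3, s4, r3, r4, hR]

/-! ## §2. Expectations under a probability measure -/

variable {Ω : Type*} [MeasurableSpace Ω] {μ : Measure Ω} {f g h k : Ω → ℝ}

/-- `x² ≤ (x⁴ + 1)∕2`, so the square is integrable once the fourth power is (probability measure). [folklore] -/
theorem integrable_sq_of_quartic [IsProbabilityMeasure μ] (hf : Measurable f) (hf4 : Integrable (fun ω => f ω ^ 4) μ) :
    Integrable (fun ω => f ω ^ 2) μ := by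
  refine ((hf4.add (integrable_const 1)).div_const 2).mono' (hf.pow_const 2).aestronglyMeasurable (ae_of_all _ fun ω => ?_)
  rw [Real.norm_eq_abs, abs_of_nonneg (sq_nonneg _)]
  have : f ω ^ 2 ≤ (f ω ^ 4 + 1) / 2 := by nlinarith [sq_nonneg (f ω ^ 2 - 1)]
  simpa using this

/-- **`fghk` is integrable** (`|fghk| ≤ Σf⁴∕4`). [folklore] -/
theorem integrable_quad [IsProbabilityMeasure μ] (hf : Measurable f) (hg : Measurable g) (hh : Measurable h) (hk : Measurable k)
    (hf4 : Integrable (fun ω => f ω ^ 4) μ) (hg4 : Integrable (fun ω => g ω ^ 4) μ) (hh4 : Integrable (fun ω => h ω ^ 4) μ)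
    (hk4 : Integrable (fun ω => k ω ^ 4) μ) : Integrable (fun ω => f ω * g ω * h ω * k ω) μ := by
  refine ((((hf4.add hg4).add hh4).add hk4).div_const 4).mono' (((hf.mul hg).mul hh).mul hk).aestronglyMeasurable (ae_of_all _ fun ω => ?_)
  rw [Real.norm_eq_abs]
  simpa using abs_quad_le (f ω) (g ω) (h ω) (k ω)

/-- **The clamped product `T_Rf·T_Rg·T_Rh·T_Rk` is integrable** (`R ≥ 0`; dominated by the unclamped moments). [folklore] -/
theorem integrable_quad_clamped [IsProbabilityMeasure μ] (hf : Measurable f) (hg : Measurable g) (hh : Measurable h) (hk : Measurable k) {R : ℝ}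
    (hR : 0 ≤ R) (hf4 : Integrable (fun ω => f ω ^ 4) μ) (hg4 : Integrable (fun ω => g ω ^ 4) μ) (hh4 : Integrable (fun ω => h ω ^ 4) μ)
    (hk4 : Integrable (fun ω => k ω ^ 4) μ) :
    Integrable (fun ω => max (-R) (min R (f ω)) * max (-R) (min R (g ω)) * max (-R) (min R (h ω)) * max (-R) (min R (k ω))) μ := by
  have hm : ∀ {φ : Ω → ℝ}, Measurable φ → Measurable fun ω => max (-R) (min R (φ ω)) := fun hφ => measurable_const.max (measurable_const.min hφ)
  have hshrink : ∀ w : ℝ, |max (-R) (min R w)| ≤ |w| := fun w => by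
    rcases le_or_gt w (-R) with h1 | h1
    · rw [min_eq_right (by linarith), max_eq_left h1, abs_of_nonpos (by linarith), abs_of_nonpos (by linarith)]; linarith
    · rcases le_or_gt w R with h2 | h2
      · rw [min_eq_right h2, max_eq_right h1.le]
      · rw [min_eq_left h2.le, max_eq_right (by linarith), abs_of_nonneg hR, abs_of_pos (by linarith)]; linarith
  refine ((((hf4.add hg4).add hh4).add hk4).div_const 4).mono' ((((hm hf).mul (hm hg)).mul (hm hh)).mul (hm hk)).aestronglyMeasurable
    (ae_of_all _ fun ω => ?_)
  rw [Real.norm_eq_abs, abs_mul, abs_mul, abs_mul]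
  have hq := abs_quad_le (f ω) (g ω) (h ω) (k ω)
  rw [abs_mul, abs_mul, abs_mul] at hq
  have h1 := hshrink (f ω); have h2 := hshrink (g ω); have h3 := hshrink (h ω); have h4 := hshrink (k ω)
  have hprod : |max (-R) (min R (f ω))| * |max (-R) (min R (g ω))| * |max (-R) (min R (h ω))| * |max (-R) (min R (k ω))| ≤
      |f ω| * |g ω| * |h ω| * |k ω| :=
    mul_le_mul (mul_le_mul (mul_le_mul h1 h2 (abs_nonneg _) (abs_nonneg _)) h3 (abs_nonneg _) (by positivity)) h4 (abs_nonneg _) (by positivity)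
  simpa using hprod.trans hq

/-- **`fg` is integrable** (`|fg| ≤ (f²+g²)∕2`). [folklore] -/
theorem integrable_pair [IsProbabilityMeasure μ] (hf : Measurable f) (hg : Measurable g) (hf4 : Integrable (fun ω => f ω ^ 4) μ)
    (hg4 : Integrable (fun ω => g ω ^ 4) μ) : Integrable (fun ω => f ω * g ω) μ := by
  have h2 := (integrable_sq_of_quartic hf hf4).add (integrable_sq_of_quartic hg hg4)
  refine (h2.div_const 2).mono' (hf.mul hg).aestronglyMeasurable (ae_of_all _ fun ω => ?_)
  rw [Real.norm_eq_abs, abs_mul]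
  have : |f ω| * |g ω| ≤ (f ω ^ 2 + g ω ^ 2) / 2 := by nlinarith [sq_nonneg (|f ω| - |g ω|), sq_abs (f ω), sq_abs (g ω)]
  simpa using this

/-- **The clamped pair `T_Rf·T_Rg` is integrable**. [folklore] -/
theorem integrable_pair_clamped [IsProbabilityMeasure μ] (hf : Measurable f) (hg : Measurable g) {R : ℝ} (hR : 0 ≤ R) (hf4 : Integrable (fun ω => f ω
    ^ 4) μ)
    (hg4 : Integrable (fun ω => g ω ^ 4) μ) : Integrable (fun ω => max (-R) (min R (f ω)) * max (-R) (min R (g ω))) μ := by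
  have hm : ∀ {φ : Ω → ℝ}, Measurable φ → Measurable fun ω => max (-R) (min R (φ ω)) := fun hφ => measurable_const.max (measurable_const.min hφ)
  have hshrink : ∀ w : ℝ, |max (-R) (min R w)| ≤ |w| := fun w => by
    rcases le_or_gt w (-R) with h1 | h1
    · rw [min_eq_right (by linarith), max_eq_left h1, abs_of_nonpos (by linarith), abs_of_nonpos (by linarith)]; linarith
    · rcases le_or_gt w R with h2 | h2
      · rw [min_eq_right h2, max_eq_right h1.le]
      · rw [min_eq_left h2.le, max_eq_right (by linarith), abs_of_nonneg hR, abs_of_pos (by linarith)]; linarith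
  have h2 := (integrable_sq_of_quartic hf hf4).add (integrable_sq_of_quartic hg hg4)
  refine (h2.div_const 2).mono' ((hm hf).mul (hm hg)).aestronglyMeasurable (ae_of_all _ fun ω => ?_)
  rw [Real.norm_eq_abs, abs_mul]
  have h0 : |f ω| * |g ω| ≤ (f ω ^ 2 + g ω ^ 2) / 2 := by nlinarith [sq_nonneg (|f ω| - |g ω|), sq_abs (f ω), sq_abs (g ω)]
  have h1 := mul_le_mul (hshrink (f ω)) (hshrink (g ω)) (abs_nonneg _) (abs_nonneg _)
  simpa using h1.trans h0

/-- **THE GROUP DEFECT IN EXPECTATION**: `|∫fghk − ∫T_RfT_RgT_RhT_Rk| ≤ (Σ∫f⁴ + Σ∫f⁶)∕(2R)`. [folklore] -/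
theorem group_expect_defect_le [IsProbabilityMeasure μ] (hf : Measurable f) (hg : Measurable g) (hh : Measurable h) (hk : Measurable k) {R : ℝ}
    (hR : 0 < R) (hf4 : Integrable (fun ω => f ω ^ 4) μ) (hg4 : Integrable (fun ω => g ω ^ 4) μ) (hh4 : Integrable (fun ω => h ω ^ 4) μ)
    (hk4 : Integrable (fun ω => k ω ^ 4) μ) (hf6 : Integrable (fun ω => f ω ^ 6) μ) (hg6 : Integrable (fun ω => g ω ^ 6) μ)
    (hh6 : Integrable (fun ω => h ω ^ 6) μ) (hk6 : Integrable (fun ω => k ω ^ 6) μ) :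
    |(∫ ω, f ω * g ω * h ω * k ω ∂μ) - ∫ ω, max (-R) (min R (f ω)) * max (-R) (min R (g ω)) * max (-R) (min R (h ω)) * max (-R) (min R (k ω)) ∂μ| ≤
      (((∫ ω, f ω ^ 4 ∂μ) + (∫ ω, g ω ^ 4 ∂μ) + (∫ ω, h ω ^ 4 ∂μ) + (∫ ω, k ω ^ 4 ∂μ)) +
        ((∫ ω, f ω ^ 6 ∂μ) + (∫ ω, g ω ^ 6 ∂μ) + (∫ ω, h ω ^ 6 ∂μ) + (∫ ω, k ω ^ 6 ∂μ))) / (2 * R) := by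
  have hI := integrable_quad hf hg hh hk hf4 hg4 hh4 hk4
  have hIT := integrable_quad_clamped hf hg hh hk hR.le hf4 hg4 hh4 hk4
  rw [← integral_sub hI hIT]
  have h4a : Integrable (fun ω => f ω ^ 4 + g ω ^ 4) μ := hf4.add hg4
  have h4b : Integrable (fun ω => f ω ^ 4 + g ω ^ 4 + h ω ^ 4) μ := h4a.add hh4
  have h4c : Integrable (fun ω => f ω ^ 4 + g ω ^ 4 + h ω ^ 4 + k ω ^ 4) μ := h4b.add hk4
  have h6a : Integrable (fun ω => f ω ^ 6 + g ω ^ 6) μ := hf6.add hg6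
  have h6b : Integrable (fun ω => f ω ^ 6 + g ω ^ 6 + h ω ^ 6) μ := h6a.add hh6
  have h6c : Integrable (fun ω => f ω ^ 6 + g ω ^ 6 + h ω ^ 6 + k ω ^ 6) μ := h6b.add hk6
  have h46 : Integrable (fun ω => (f ω ^ 4 + g ω ^ 4 + h ω ^ 4 + k ω ^ 4) + (f ω ^ 6 + g ω ^ 6 + h ω ^ 6 + k ω ^ 6)) μ := h4c.add h6c
  have hbound : Integrable (fun ω => ((f ω ^ 4 + g ω ^ 4 + h ω ^ 4 + k ω ^ 4) + (f ω ^ 6 + g ω ^ 6 + h ω ^ 6 + k ω ^ 6)) / (2 * R)) μ :=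
    h46.div_const (2 * R)
  refine (abs_integral_le_integral_abs).trans ((integral_mono_of_nonneg (ae_of_all _ fun ω => abs_nonneg _) hbound
    (ae_of_all _ fun ω => quad_sub_clamp_quad_abs_le hR (f ω) (g ω) (h ω) (k ω))).trans (le_of_eq ?_))
  rw [integral_div, integral_add h4c h6c, integral_add h4b hk4, integral_add h4a hh4, integral_add hf4 hg4, integral_add h6b hk6,
    integral_add h6a hh6, integral_add hf6 hg6]

/-- **The pair defect in expectation**: `|∫fg − ∫T_RfT_Rg| ≤ (∫f⁴ + ∫g² + ∫g⁴ + ∫f²)∕(2R)`. [folklore] -/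
theorem pair_expect_defect_le [IsProbabilityMeasure μ] (hf : Measurable f) (hg : Measurable g) {R : ℝ} (hR : 0 < R) (hf4 : Integrable (fun ω => f ω ^
    4) μ)
    (hg4 : Integrable (fun ω => g ω ^ 4) μ) :
    |(∫ ω, f ω * g ω ∂μ) - ∫ ω, max (-R) (min R (f ω)) * max (-R) (min R (g ω)) ∂μ| ≤
      ((∫ ω, f ω ^ 4 ∂μ) + (∫ ω, g ω ^ 2 ∂μ) + (∫ ω, g ω ^ 4 ∂μ) + (∫ ω, f ω ^ 2 ∂μ)) / (2 * R) := by
  have hf2 := integrable_sq_of_quartic hf hf4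
  have hg2 := integrable_sq_of_quartic hg hg4
  rw [← integral_sub (integrable_pair hf hg hf4 hg4) (integrable_pair_clamped hf hg hR.le hf4 hg4)]
  have hs1 : Integrable (fun ω => f ω ^ 4 + g ω ^ 2) μ := hf4.add hg2
  have hs2 : Integrable (fun ω => f ω ^ 4 + g ω ^ 2 + g ω ^ 4) μ := hs1.add hg4
  have hsum : Integrable (fun ω => f ω ^ 4 + g ω ^ 2 + g ω ^ 4 + f ω ^ 2) μ := hs2.add hf2
  have hsumR : Integrable (fun ω => (f ω ^ 4 + g ω ^ 2 + g ω ^ 4 + f ω ^ 2) / (2 * R)) μ := hsum.div_const (2 * R)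
  have hdom : ∀ ω, |f ω * g ω - max (-R) (min R (f ω)) * max (-R) (min R (g ω))| ≤ (f ω ^ 4 + g ω ^ 2 + g ω ^ 4 + f ω ^ 2) / (2 * R) := fun ω => by
    have h1 := prod_sub_clamp_prod_abs_le hR (f ω) (g ω)
    have h2 := sq_mul_abs_le (f ω) (g ω)
    have h3 := sq_mul_abs_le (g ω) (f ω)
    have e : |f ω| * g ω ^ 2 = g ω ^ 2 * |f ω| := by ring
    rw [e] at h1
    calc |f ω * g ω - max (-R) (min R (f ω)) * max (-R) (min R (g ω))| ≤ (f ω ^ 2 * |g ω| + g ω ^ 2 * |f ω|) / R := h1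
      _ ≤ ((f ω ^ 4 + g ω ^ 2) / 2 + (g ω ^ 4 + f ω ^ 2) / 2) / R := div_le_div_of_nonneg_right (add_le_add h2 h3) hR.le
      _ = (f ω ^ 4 + g ω ^ 2 + g ω ^ 4 + f ω ^ 2) / (2 * R) := by field_simp; ring
  refine (abs_integral_le_integral_abs).trans ((integral_mono_of_nonneg (ae_of_all _ fun ω => abs_nonneg _) hsumR
    (ae_of_all _ hdom)).trans (le_of_eq ?_))
  rw [integral_div, integral_add hs2 hf2, integral_add hs1 hg4, integral_add hf4 hg2]

/-- `|∫fg| ≤ (∫f² + ∫g²)∕2`. [folklore] -/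
theorem abs_expect_pair_le [IsProbabilityMeasure μ] (hf : Measurable f) (hg : Measurable g) (hf4 : Integrable (fun ω => f ω ^ 4) μ)
    (hg4 : Integrable (fun ω => g ω ^ 4) μ) : |∫ ω, f ω * g ω ∂μ| ≤ ((∫ ω, f ω ^ 2 ∂μ) + (∫ ω, g ω ^ 2 ∂μ)) / 2 := by
  have hf2 := integrable_sq_of_quartic hf hf4
  have hg2 := integrable_sq_of_quartic hg hg4
  have hb : Integrable (fun ω => (f ω ^ 2 + g ω ^ 2) / 2) μ := (hf2.add hg2).div_const 2
  refine (abs_integral_le_integral_abs).trans ((integral_mono_of_nonneg (ae_of_all _ fun ω => abs_nonneg _) hb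
    (ae_of_all _ fun ω => ?_)).trans (le_of_eq ?_))
  · have : |f ω * g ω| ≤ (f ω ^ 2 + g ω ^ 2) / 2 := by
      rw [abs_mul]; nlinarith [sq_nonneg (|f ω| - |g ω|), sq_abs (f ω), sq_abs (g ω)]
    simpa using this
  · rw [integral_div, integral_add hf2 hg2]

/-- `|∫T_RfT_Rg| ≤ (∫f² + ∫g²)∕2` (`R ≥ 0`). [folklore] -/
theorem abs_expect_clamped_pair_le [IsProbabilityMeasure μ] (hf : Measurable f) (hg : Measurable g) {R : ℝ} (hR : 0 ≤ R) (hf4 : Integrable (fun ω =>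
    f ω ^ 4) μ)
    (hg4 : Integrable (fun ω => g ω ^ 4) μ) : |∫ ω, max (-R) (min R (f ω)) * max (-R) (min R (g ω)) ∂μ| ≤ ((∫ ω, f ω ^ 2 ∂μ) + (∫ ω, g ω ^ 2 ∂μ)) / 2
        := by
  have hf2 := integrable_sq_of_quartic hf hf4
  have hg2 := integrable_sq_of_quartic hg hg4
  have hshrink : ∀ w : ℝ, |max (-R) (min R w)| ≤ |w| := fun w => by
    rcases le_or_gt w (-R) with h1 | h1
    · rw [min_eq_right (by linarith), max_eq_left h1, abs_of_nonpos (by linarith), abs_of_nonpos (by linarith)]; linarith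
    · rcases le_or_gt w R with h2 | h2
      · rw [min_eq_right h2, max_eq_right h1.le]
      · rw [min_eq_left h2.le, max_eq_right (by linarith), abs_of_nonneg hR, abs_of_pos (by linarith)]; linarith
  have hb : Integrable (fun ω => (f ω ^ 2 + g ω ^ 2) / 2) μ := (hf2.add hg2).div_const 2
  refine (abs_integral_le_integral_abs).trans ((integral_mono_of_nonneg (ae_of_all _ fun ω => abs_nonneg _) hb
    (ae_of_all _ fun ω => ?_)).trans (le_of_eq ?_))
  · have h0 : |f ω| * |g ω| ≤ (f ω ^ 2 + g ω ^ 2) / 2 := by nlinarith [sq_nonneg (|f ω| - |g ω|), sq_abs (f ω), sq_abs (g ω)]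
    have h1 := mul_le_mul (hshrink (f ω)) (hshrink (g ω)) (abs_nonneg _) (abs_nonneg _)
    have : |max (-R) (min R (f ω)) * max (-R) (min R (g ω))| ≤ (f ω ^ 2 + g ω ^ 2) / 2 := by rw [abs_mul]; exact h1.trans h0
    simpa using this
  · rw [integral_div, integral_add hf2 hg2]

/-! ## §3. THE ENDS: the covariance across the cut -/

/-- **THE GROUP TRUNCATION SPLIT**: with all second∕fourth∕sixth moments of `f, g, h, k` bounded by `m₂, m₄, m₆`, for every `R > 0`,
`|Cov(fg,hk) − Cov(T_RfT_Rg, T_RhT_Rk)| ≤ (2m₄ + 2m₆ + 2m₂(m₂ + m₄))∕R`. [folklore] -/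
theorem cov_group_split_le [IsProbabilityMeasure μ] (hf : Measurable f) (hg : Measurable g) (hh : Measurable h) (hk : Measurable k) {R m₂ m₄ m₆ : ℝ}
    (hR : 0 < R) (hf4 : Integrable (fun ω => f ω ^ 4) μ) (hg4 : Integrable (fun ω => g ω ^ 4) μ) (hh4 : Integrable (fun ω => h ω ^ 4) μ)
    (hk4 : Integrable (fun ω => k ω ^ 4) μ) (hf6 : Integrable (fun ω => f ω ^ 6) μ) (hg6 : Integrable (fun ω => g ω ^ 6) μ)
    (hh6 : Integrable (fun ω => h ω ^ 6) μ) (hk6 : Integrable (fun ω => k ω ^ 6) μ)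
    (hf2m : ∫ ω, f ω ^ 2 ∂μ ≤ m₂) (hg2m : ∫ ω, g ω ^ 2 ∂μ ≤ m₂) (hh2m : ∫ ω, h ω ^ 2 ∂μ ≤ m₂) (hk2m : ∫ ω, k ω ^ 2 ∂μ ≤ m₂)
    (hf4m : ∫ ω, f ω ^ 4 ∂μ ≤ m₄) (hg4m : ∫ ω, g ω ^ 4 ∂μ ≤ m₄) (hh4m : ∫ ω, h ω ^ 4 ∂μ ≤ m₄) (hk4m : ∫ ω, k ω ^ 4 ∂μ ≤ m₄)
    (hf6m : ∫ ω, f ω ^ 6 ∂μ ≤ m₆) (hg6m : ∫ ω, g ω ^ 6 ∂μ ≤ m₆) (hh6m : ∫ ω, h ω ^ 6 ∂μ ≤ m₆) (hk6m : ∫ ω, k ω ^ 6 ∂μ ≤ m₆) :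
    |((∫ ω, f ω * g ω * h ω * k ω ∂μ) - (∫ ω, f ω * g ω ∂μ) * (∫ ω, h ω * k ω ∂μ)) -
        ((∫ ω, max (-R) (min R (f ω)) * max (-R) (min R (g ω)) * max (-R) (min R (h ω)) * max (-R) (min R (k ω)) ∂μ) -
          (∫ ω, max (-R) (min R (f ω)) * max (-R) (min R (g ω)) ∂μ) * (∫ ω, max (-R) (min R (h ω)) * max (-R) (min R (k ω)) ∂μ))| ≤
      (2 * m₄ + 2 * m₆ + 2 * m₂ * (m₂ + m₄)) / R := by
  have hm2 : 0 ≤ m₂ := le_trans (integral_nonneg fun ω => sq_nonneg (f ω)) hf2m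
  -- the four pieces
  have d1 := group_expect_defect_le hf hg hh hk hR hf4 hg4 hh4 hk4 hf6 hg6 hh6 hk6
  have d2 := pair_expect_defect_le hf hg hR hf4 hg4
  have d3 := pair_expect_defect_le hh hk hR hh4 hk4
  have p1 := abs_expect_pair_le hh hk hh4 hk4
  have p2 := abs_expect_clamped_pair_le hf hg hR.le hf4 hg4
  -- abbreviations
  set X := ∫ ω, f ω * g ω * h ω * k ω ∂μ
  set X' := ∫ ω, max (-R) (min R (f ω)) * max (-R) (min R (g ω)) * max (-R) (min R (h ω)) * max (-R) (min R (k ω)) ∂μ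
  set P := ∫ ω, f ω * g ω ∂μ
  set P' := ∫ ω, max (-R) (min R (f ω)) * max (-R) (min R (g ω)) ∂μ
  set Q := ∫ ω, h ω * k ω ∂μ
  set Q' := ∫ ω, max (-R) (min R (h ω)) * max (-R) (min R (k ω)) ∂μ
  -- `|X − X'| ≤ (4m₄ + 4m₆)/(2R)`
  have h2R : 0 ≤ 2 * R := by linarith
  have e1 : |X - X'| ≤ (4 * m₄ + 4 * m₆) / (2 * R) := by
    refine d1.trans (div_le_div_of_nonneg_right ?_ h2R)
    linarith
  -- `|P − P'| ≤ (2m₄ + 2m₂)/(2R)`, `|Q − Q'|` likewise, `|Q| ≤ m₂`, `|P'| ≤ m₂`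
  have e2 : |P - P'| ≤ (2 * m₄ + 2 * m₂) / (2 * R) := by
    refine d2.trans (div_le_div_of_nonneg_right ?_ h2R)
    linarith
  have e3 : |Q - Q'| ≤ (2 * m₄ + 2 * m₂) / (2 * R) := by
    refine d3.trans (div_le_div_of_nonneg_right ?_ h2R)
    linarith
  have e4 : |Q| ≤ m₂ := p1.trans (by linarith)
  have e5 : |P'| ≤ m₂ := p2.trans (by linarith)
  -- `|PQ − P'Q'| ≤ |P − P'||Q| + |P'||Q − Q'|`
  have e6 : |P * Q - P' * Q'| ≤ (2 * m₄ + 2 * m₂) / (2 * R) * m₂ + m₂ * ((2 * m₄ + 2 * m₂) / (2 * R)) := by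
    have e : P * Q - P' * Q' = (P - P') * Q + P' * (Q - Q') := by ring
    rw [e]
    refine (abs_add_le _ _).trans ?_
    rw [abs_mul, abs_mul]
    have hm4 : 0 ≤ m₄ := le_trans (integral_nonneg fun ω => by positivity) hf4m
    have hnn : 0 ≤ (2 * m₄ + 2 * m₂) / (2 * R) := div_nonneg (by linarith) h2R
    exact add_le_add (mul_le_mul e2 e4 (abs_nonneg _) hnn) (mul_le_mul e5 e3 (abs_nonneg _) hm2)
  have e7 : |X - P * Q - (X' - P' * Q')| ≤ |X - X'| + |P * Q - P' * Q'| := by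
    have e : X - P * Q - (X' - P' * Q') = (X - X') - (P * Q - P' * Q') := by ring
    rw [e]; exact abs_sub _ _
  have etot : (4 * m₄ + 4 * m₆) / (2 * R) + ((2 * m₄ + 2 * m₂) / (2 * R) * m₂ + m₂ * ((2 * m₄ + 2 * m₂) / (2 * R))) =
      (2 * m₄ + 2 * m₆ + 2 * m₂ * (m₂ + m₄)) / R := by field_simp; ring
  linarith

/-- **THE END — THE COVARIANCE ACROSS THE CUT FROM ITS TRUNCATION**: if the clamped covariance is `≤ R²·B` (Dobrushin for two clamped
products, the successor), then `|Cov(fg,hk)| ≤ R²·B + (2m₄ + 2m₆ + 2m₂(m₂ + m₄))∕R` — for every `R > 0`. [folklore] -/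
theorem cov_group_le_of_truncated [IsProbabilityMeasure μ] (hf : Measurable f) (hg : Measurable g) (hh : Measurable h) (hk : Measurable k)
    {R m₂ m₄ m₆ B : ℝ} (hR : 0 < R) (hf4 : Integrable (fun ω => f ω ^ 4) μ) (hg4 : Integrable (fun ω => g ω ^ 4) μ)
    (hh4 : Integrable (fun ω => h ω ^ 4) μ) (hk4 : Integrable (fun ω => k ω ^ 4) μ) (hf6 : Integrable (fun ω => f ω ^ 6) μ)
    (hg6 : Integrable (fun ω => g ω ^ 6) μ) (hh6 : Integrable (fun ω => h ω ^ 6) μ) (hk6 : Integrable (fun ω => k ω ^ 6) μ)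
    (hf2m : ∫ ω, f ω ^ 2 ∂μ ≤ m₂) (hg2m : ∫ ω, g ω ^ 2 ∂μ ≤ m₂) (hh2m : ∫ ω, h ω ^ 2 ∂μ ≤ m₂) (hk2m : ∫ ω, k ω ^ 2 ∂μ ≤ m₂)
    (hf4m : ∫ ω, f ω ^ 4 ∂μ ≤ m₄) (hg4m : ∫ ω, g ω ^ 4 ∂μ ≤ m₄) (hh4m : ∫ ω, h ω ^ 4 ∂μ ≤ m₄) (hk4m : ∫ ω, k ω ^ 4 ∂μ ≤ m₄)
    (hf6m : ∫ ω, f ω ^ 6 ∂μ ≤ m₆) (hg6m : ∫ ω, g ω ^ 6 ∂μ ≤ m₆) (hh6m : ∫ ω, h ω ^ 6 ∂μ ≤ m₆) (hk6m : ∫ ω, k ω ^ 6 ∂μ ≤ m₆)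
    (hT : |(∫ ω, max (-R) (min R (f ω)) * max (-R) (min R (g ω)) * max (-R) (min R (h ω)) * max (-R) (min R (k ω)) ∂μ) -
        (∫ ω, max (-R) (min R (f ω)) * max (-R) (min R (g ω)) ∂μ) * (∫ ω, max (-R) (min R (h ω)) * max (-R) (min R (k ω)) ∂μ)| ≤ R ^ 2 * B) :
    |(∫ ω, f ω * g ω * h ω * k ω ∂μ) - (∫ ω, f ω * g ω ∂μ) * (∫ ω, h ω * k ω ∂μ)| ≤ R ^ 2 * B + (2 * m₄ + 2 * m₆ + 2 * m₂ * (m₂ + m₄)) / R := by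
  have hsplit := cov_group_split_le hf hg hh hk hR hf4 hg4 hh4 hk4 hf6 hg6 hh6 hk6 hf2m hg2m hh2m hk2m hf4m hg4m hh4m hk4m hf6m hg6m hh6m
    hk6m
  have tri := abs_sub_abs_le_abs_sub ((∫ ω, f ω * g ω * h ω * k ω ∂μ) - (∫ ω, f ω * g ω ∂μ) * (∫ ω, h ω * k ω ∂μ))
    ((∫ ω, max (-R) (min R (f ω)) * max (-R) (min R (g ω)) * max (-R) (min R (h ω)) * max (-R) (min R (k ω)) ∂μ) -
      (∫ ω, max (-R) (min R (f ω)) * max (-R) (min R (g ω)) ∂μ) * (∫ ω, max (-R) (min R (h ω)) * max (-R) (min R (k ω)) ∂μ))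
  linarith

end Summit.QuantumFields.BalabanUV.T4Continuum.NE7b.SupTruncationGroupBound

end
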